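/-
Copyright (c) 2026. All rights reserved.
Released under Apache 2.0 license as described in the file LICENSE.
Authors: abc-iut cell, prover seat abc-iut-E-t42 (gen 7).
-/
import Mathlib.Tactic
import HarnessLib

/-!
# A kernel-checkable certificate format for excluding integer quartics (Hunter–Pohst enumeration)

Computable plumbing (no `Prop` fact, no instance; elementary algebra) for the finite step of a Hunter–Pohst style
enumeration of quartic number fields of prescribed discriminant: integer coefficient lists with evaluation
(`evalL`) and ring operations (`addL`, `smulL`, `mulL`), Newton power sums `psum s k` of the integer characteristic
data `s = (s₁, s₂, s₃, s₄)` of `X⁴ − s₁X³ + s₂X² − s₃X + s₄`, the `4 × 4` Hankel determinant `hankelDet s` of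
`(p_{i+j})` (= the discriminant), and five CERTIFICATE TESTS, each a `Bool` with a soundness lemma:

* `notSqClass D H` — `H` is not of the form `m²·D` (divisibility / sign / a non-residue modulus `≤ 17`);
* `hasIntRoot s` — the quartic has a root in `{±1, ±2}`;
* `powKill c s` — some power sum has `100^k·|p_k| > 4·c^k` (`k < 12`);
* `checkSqrt s (g, d, q, M)` — `g² − d = q·χ_s` as integer polynomials and `d` is a non-square (so `g(a)² = d`);
* `checkPos s (u, v, k)` — `χ_s = (t² + ut + v)² + (positive quadratic)` and `100^k·|p_k| > 2(210^k + 120^k)`.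

The number-theoretic meaning (why each test excludes or resolves a candidate) is supplied by
`QuarticSmallDiscriminant.lean`; this file is ring-theory only. [cite: EsmondeMurty1999, Ex. 6.5.12 and Ex. 6.5.21 p. 93]
-/

namespace Literature.NumberTheory.NumberFields

namespace QuarticCert

/-! ## Integer coefficient lists -/

/-- Evaluate an integer coefficient list (constant term first) in a commutative ring.
[cite: EsmondeMurty1999, Ex. 6.5.12 and Ex. 6.5.21 p. 93] -/
def evalL {R : Type*} [CommRing R] : List ℤ → R → R
  | [], _ => 0
  | c :: cs, x => (c : R) + x * evalL cs x

/-- Coefficientwise sum. [cite: EsmondeMurty1999, Ex. 6.5.12 and Ex. 6.5.21 p. 93] -/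
def addL : List ℤ → List ℤ → List ℤ
  | [], l => l
  | l, [] => l
  | a :: as, b :: bs => (a + b) :: addL as bs

/-- Scalar multiple. [cite: EsmondeMurty1999, Ex. 6.5.12 and Ex. 6.5.21 p. 93] -/
def smulL (c : ℤ) : List ℤ → List ℤ
  | [] => []
  | a :: as => (c * a) :: smulL c as

/-- Product. [cite: EsmondeMurty1999, Ex. 6.5.12 and Ex. 6.5.21 p. 93] -/
def mulL : List ℤ → List ℤ → List ℤ
  | [], _ => []
  | a :: as, l => addL (smulL a l) (0 :: mulL as l)

/-- All coefficients vanish. [cite: EsmondeMurty1999, Ex. 6.5.12 and Ex. 6.5.21 p. 93] -/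
def isZeroL : List ℤ → Bool
  | [] => true
  | a :: as => (a == 0) && isZeroL as

section Eval

variable {R : Type*} [CommRing R] (x : R)

/-- `evalL [] = 0`. [cite: EsmondeMurty1999, Ex. 6.5.12 and Ex. 6.5.21 p. 93] -/
@[simp] theorem evalL_nil : evalL ([] : List ℤ) x = 0 := rfl

/-- `evalL (c :: cs) x = c + x · evalL cs x` (Horner). [cite: EsmondeMurty1999, Ex. 6.5.12 and Ex. 6.5.21 p. 93] -/
@[simp] theorem evalL_cons (c : ℤ) (cs : List ℤ) : evalL (c :: cs) x = (c : R) + x * evalL cs x := rfl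

/-- `evalL` is additive. [cite: EsmondeMurty1999, Ex. 6.5.12 and Ex. 6.5.21 p. 93] -/
theorem evalL_addL : ∀ (a b : List ℤ), evalL (addL a b) x = evalL a x + evalL b x
  | [], l => by simp [addL]
  | a :: as, [] => by simp [addL]
  | a :: as, b :: bs => by
    simp only [addL, evalL_cons, Int.cast_add, evalL_addL as bs]
    ring

/-- `evalL` commutes with scalars. [cite: EsmondeMurty1999, Ex. 6.5.12 and Ex. 6.5.21 p. 93] -/
theorem evalL_smulL (c : ℤ) : ∀ (a : List ℤ), evalL (smulL c a) x = (c : R) * evalL a x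
  | [] => by simp [smulL]
  | a :: as => by
    simp only [smulL, evalL_cons, Int.cast_mul, evalL_smulL c as]
    ring

/-- `evalL` is multiplicative. [cite: EsmondeMurty1999, Ex. 6.5.12 and Ex. 6.5.21 p. 93] -/
theorem evalL_mulL : ∀ (a b : List ℤ), evalL (mulL a b) x = evalL a x * evalL b x
  | [], l => by simp [mulL]
  | a :: as, l => by
    rw [mulL, evalL_addL, evalL_smulL, evalL_cons, evalL_cons, evalL_mulL as l]
    push_cast
    ring

/-- A list of zeros evaluates to `0`. [cite: EsmondeMurty1999, Ex. 6.5.12 and Ex. 6.5.21 p. 93] -/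
theorem evalL_eq_zero_of_isZeroL : ∀ (a : List ℤ), isZeroL a = true → evalL a x = 0
  | [], _ => rfl
  | a :: as, h => by
    simp only [isZeroL, Bool.and_eq_true, beq_iff_eq] at h
    rw [evalL_cons, h.1, evalL_eq_zero_of_isZeroL as h.2]
    simp

/-- Ring homomorphisms commute with `evalL`. [cite: EsmondeMurty1999, Ex. 6.5.12 and Ex. 6.5.21 p. 93] -/
theorem map_evalL {S : Type*} [CommRing S] (f : R →+* S) : ∀ (a : List ℤ), f (evalL a x) = evalL a (f x)
  | [] => by simp
  | a :: as => by simp [map_evalL f as]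

end Eval

/-! ## The characteristic quartic, Newton power sums, Hankel determinant -/

/-- Coefficient list of `χ_s = X⁴ − s₁X³ + s₂X² − s₃X + s₄`. [cite: EsmondeMurty1999, Ex. 6.5.12 and Ex. 6.5.21 p. 93] -/
def chiL (s : ℤ × ℤ × ℤ × ℤ) : List ℤ := [s.2.2.2, -s.2.2.1, s.2.1, -s.1, 1]

/-- `evalL (chiL s) x = x⁴ − s₁x³ + s₂x² − s₃x + s₄`. [cite: EsmondeMurty1999, Ex. 6.5.12 and Ex. 6.5.21 p. 93] -/
theorem evalL_chiL {R : Type*} [CommRing R] (s : ℤ × ℤ × ℤ × ℤ) (x : R) :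
    evalL (chiL s) x = x ^ 4 - (s.1 : R) * x ^ 3 + (s.2.1 : R) * x ^ 2 - (s.2.2.1 : R) * x + (s.2.2.2 : R) := by
  simp [chiL]
  ring

/-- `χ_s` evaluated at an integer. [cite: EsmondeMurty1999, Ex. 6.5.12 and Ex. 6.5.21 p. 93] -/
def chiAt (s : ℤ × ℤ × ℤ × ℤ) (r : ℤ) : ℤ := r ^ 4 - s.1 * r ^ 3 + s.2.1 * r ^ 2 - s.2.2.1 * r + s.2.2.2

/-- Four consecutive Newton power sums `(p_n, p_{n+1}, p_{n+2}, p_{n+3})` of `χ_s`, by the linear recurrence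
`p_{n+4} = s₁p_{n+3} − s₂p_{n+2} + s₃p_{n+1} − s₄p_n` from `(4, s₁, s₁² − 2s₂, s₁³ − 3s₁s₂ + 3s₃)`.
[cite: EsmondeMurty1999, Ex. 6.5.12 and Ex. 6.5.21 p. 93] -/
def psum4 (s : ℤ × ℤ × ℤ × ℤ) : ℕ → ℤ × ℤ × ℤ × ℤ
  | 0 => (4, s.1, s.1 ^ 2 - 2 * s.2.1, s.1 ^ 3 - 3 * s.1 * s.2.1 + 3 * s.2.2.1)
  | n + 1 =>
    ((psum4 s n).2.1, (psum4 s n).2.2.1, (psum4 s n).2.2.2,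
      s.1 * (psum4 s n).2.2.2 - s.2.1 * (psum4 s n).2.2.1 + s.2.2.1 * (psum4 s n).2.1 - s.2.2.2 * (psum4 s n).1)

/-- The `n`-th Newton power sum of `χ_s`. [cite: EsmondeMurty1999, Ex. 6.5.12 and Ex. 6.5.21 p. 93] -/
def psum (s : ℤ × ℤ × ℤ × ℤ) (n : ℕ) : ℤ := (psum4 s n).1

/-- `3 × 3` determinant. [cite: EsmondeMurty1999, Ex. 6.5.12 and Ex. 6.5.21 p. 93] -/
def det3 (a b c d e f g h i : ℤ) : ℤ := a * (e * i - f * h) - b * (d * i - f * g) + c * (d * h - e * g)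

/-- The Hankel determinant `det (p_{i+j})_{0 ≤ i,j ≤ 3}` (the discriminant of `χ_s`), expanded along the first row.
[cite: EsmondeMurty1999, Ex. 6.5.12 and Ex. 6.5.21 p. 93] -/
def hankelDet (s : ℤ × ℤ × ℤ × ℤ) : ℤ :=
  let p0 := psum s 0
  let p1 := psum s 1
  let p2 := psum s 2
  let p3 := psum s 3
  let p4 := psum s 4
  let p5 := psum s 5
  let p6 := psum s 6
  p0 * det3 p2 p3 p4 p3 p4 p5 p4 p5 p6 - p1 * det3 p1 p3 p4 p2 p4 p5 p3 p5 p6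
    + p2 * det3 p1 p2 p4 p2 p3 p5 p3 p4 p6 - p3 * det3 p1 p2 p3 p2 p3 p4 p3 p4 p5

/-- `hankelDet` is the determinant of the Hankel matrix of `psum`. [cite: EsmondeMurty1999, Ex. 6.5.12 and Ex. 6.5.21 p. 93] -/
theorem hankelDet_eq_det (s : ℤ × ℤ × ℤ × ℤ) :
    hankelDet s = (Matrix.of fun i j : Fin 4 => psum s ((i : ℕ) + (j : ℕ))).det := by
  have e : ∀ (j : Fin 4) (b : Fin 3), ((Fin.succAbove j b : Fin 4) : ℕ) = if (b : ℕ) < (j : ℕ) then (b : ℕ) else (b : ℕ) + 1 := by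
    decide
  simp [Matrix.det_succ_row_zero, Fin.sum_univ_succ, hankelDet, det3, e]
  ring

/-! ## Certificate tests -/

/-- `r` is a quadratic non-residue modulo `M`, tested by brute force. [cite: EsmondeMurty1999, Ex. 6.5.12 and Ex. 6.5.21 p. 93] -/
def nonResidue (M : ℕ) (r : ℤ) : Bool :=
  (List.range M).all fun t => ((t : ℤ) * (t : ℤ)) % (M : ℤ) != r

/-- The moduli tried by `notSqClass` / `checkSqrt`. [cite: EsmondeMurty1999, Ex. 6.5.12 and Ex. 6.5.21 p. 93] -/
def moduli : List ℕ := [3, 4, 5, 7, 8, 9, 11, 13, 16, 17, 19, 23, 25]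

/-- A non-negative integer is certified NOT to be a perfect square. [cite: EsmondeMurty1999, Ex. 6.5.12 and Ex. 6.5.21 p. 93] -/
def nonSquare (q : ℤ) : Bool :=
  decide (q < 0) || moduli.any fun M => nonResidue M (q % (M : ℤ))

/-- `H` is certified not to be of the form `m² · D`. [cite: EsmondeMurty1999, Ex. 6.5.12 and Ex. 6.5.21 p. 93] -/
def notSqClass (D H : ℤ) : Bool :=
  !(decide (H % D = 0)) || nonSquare (H / D)

/-- The quartic `χ_s` has a root in `{1, −1, 2, −2}`. [cite: EsmondeMurty1999, Ex. 6.5.12 and Ex. 6.5.21 p. 93] -/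
def hasIntRoot (s : ℤ × ℤ × ℤ × ℤ) : Bool :=
  [1, -1, 2, -2].any fun r => chiAt s r == 0

/-- Power-sum kill: some `k < 12` has `100^k · |p_k| > 4 · c^k`. [cite: EsmondeMurty1999, Ex. 6.5.12 and Ex. 6.5.21 p. 93] -/
def powKill (c : ℕ) (s : ℤ × ℤ × ℤ × ℤ) : Bool :=
  (List.range 12).any fun k => decide (4 * (c : ℤ) ^ k < 100 ^ k * |psum s k|)

/-- Square-root witness test: `g² − d = q · χ_s` coefficientwise and `d` is a certified non-square.
[cite: EsmondeMurty1999, Ex. 6.5.12 and Ex. 6.5.21 p. 93] -/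
def checkSqrt (s : ℤ × ℤ × ℤ × ℤ) (w : List ℤ × ℤ × List ℤ) : Bool :=
  isZeroL (addL (addL (mulL w.1 w.1) [-w.2.1]) (smulL (-1) (mulL w.2.2 (chiL s)))) && nonSquare w.2.1

/-- Positivity-and-pairing test: `s₁ = −2u`, `χ_s − (t² + ut + v)²` is a positive definite quadratic, and some power
sum has `100^k·|p_k| > 2(210^k + 120^k)`. [cite: EsmondeMurty1999, Ex. 6.5.12 and Ex. 6.5.21 p. 93] -/
def checkPos (s : ℤ × ℤ × ℤ × ℤ) (w : ℤ × ℤ × ℕ) : Bool :=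
  let u := w.1
  let v := w.2.1
  let k := w.2.2
  let q2 := s.2.1 - u ^ 2 - 2 * v
  let q1 := -s.2.2.1 - 2 * u * v
  let q0 := s.2.2.2 - v ^ 2
  decide (s.1 + 2 * u = 0) && decide (0 < q2) && decide (0 < 4 * q2 * q0 - q1 ^ 2) &&
    decide (2 * ((210 : ℤ) ^ k + 120 ^ k) < 100 ^ k * |psum s k|)

/-- One candidate `s` against one discriminant `D`: accepted iff some certificate test fires.
[cite: EsmondeMurty1999, Ex. 6.5.12 and Ex. 6.5.21 p. 93] -/
def certOK (D : ℤ) (c : ℕ) (sq : List ((ℤ × ℤ × ℤ × ℤ) × (List ℤ × ℤ × List ℤ)))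
    (ps : List ((ℤ × ℤ × ℤ × ℤ) × (ℤ × ℤ × ℕ))) (s : ℤ × ℤ × ℤ × ℤ) : Bool :=
  notSqClass D (hankelDet s) || hasIntRoot s || powKill c s ||
    (sq.any fun e => decide (e.1 = s) && checkSqrt s e.2) || (ps.any fun e => decide (e.1 = s) && checkPos s e.2)

/-- The symmetric integer range `[−b, b]`. [cite: EsmondeMurty1999, Ex. 6.5.12 and Ex. 6.5.21 p. 93] -/
def irange (b : ℕ) : List ℤ := List.map (fun n : ℕ => (n : ℤ) - (b : ℤ)) (List.range (2 * b + 1))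

/-- The box of candidate characteristic data: `|s₁| ≤ b₁`, `|s₂| ≤ b₂`, `|s₃| ≤ b₃`, `s₄ = ±2`.
[cite: EsmondeMurty1999, Ex. 6.5.12 and Ex. 6.5.21 p. 93] -/
def box (b₁ b₂ b₃ : ℕ) : List (ℤ × ℤ × ℤ × ℤ) :=
  (irange b₁).flatMap fun s₁ => (irange b₂).flatMap fun s₂ => (irange b₃).flatMap fun s₃ =>
    [(s₁, s₂, s₃, 2), (s₁, s₂, s₃, -2)]

/-! ## Soundness of the tests (ring-theoretic part) -/

/-- Membership in `irange`. [cite: EsmondeMurty1999, Ex. 6.5.12 and Ex. 6.5.21 p. 93] -/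
theorem mem_irange {b : ℕ} {z : ℤ} (hz : |z| ≤ b) : z ∈ irange b := by
  have := abs_le.mp hz
  have h0 : (((z + b).toNat : ℕ) : ℤ) = z + b := Int.toNat_of_nonneg (by omega)
  unfold irange
  rw [List.mem_map]
  refine ⟨(z + b).toNat, ?_, ?_⟩
  · rw [List.mem_range]; omega
  · omega

/-- Membership in `box`. [cite: EsmondeMurty1999, Ex. 6.5.12 and Ex. 6.5.21 p. 93] -/
theorem mem_box {b₁ b₂ b₃ : ℕ} {s₁ s₂ s₃ s₄ : ℤ} (h₁ : |s₁| ≤ b₁) (h₂ : |s₂| ≤ b₂) (h₃ : |s₃| ≤ b₃)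
    (h₄ : s₄ = 2 ∨ s₄ = -2) : (s₁, s₂, s₃, s₄) ∈ box b₁ b₂ b₃ := by
  simp only [box, List.mem_flatMap, List.mem_cons, Prod.mk.injEq]
  refine ⟨s₁, mem_irange h₁, s₂, mem_irange h₂, s₃, mem_irange h₃, ?_⟩
  rcases h₄ with h | h
  · exact Or.inl ⟨rfl, rfl, rfl, h⟩
  · exact Or.inr (Or.inl ⟨rfl, rfl, rfl, h⟩)

/-- Soundness of `nonResidue`: a square is a residue. [cite: EsmondeMurty1999, Ex. 6.5.12 and Ex. 6.5.21 p. 93] -/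
theorem nonResidue_sq_false {M : ℕ} (hM : 0 < M) (m : ℤ) (h : nonResidue M ((m * m) % (M : ℤ)) = true) : False := by
  rw [nonResidue, List.all_eq_true] at h
  have hMz : (0 : ℤ) < (M : ℤ) := by exact_mod_cast hM
  set t := m % (M : ℤ) with ht
  have ht0 : 0 ≤ t := Int.emod_nonneg _ hMz.ne'
  have htM : t < M := Int.emod_lt_of_pos _ hMz
  have hmem : t.toNat ∈ List.range M := by
    rw [List.mem_range]; omega
  have := h t.toNat hmem
  rw [Int.toNat_of_nonneg ht0, bne_iff_ne, ne_eq] at this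
  apply this
  rw [ht, ← Int.mul_emod]

/-- Soundness of `nonSquare`. [cite: EsmondeMurty1999, Ex. 6.5.12 and Ex. 6.5.21 p. 93] -/
theorem not_isSquare_of_nonSquare {q : ℤ} (h : nonSquare q = true) : ¬ IsSquare q := by
  rintro ⟨m, rfl⟩
  rw [nonSquare, Bool.or_eq_true, decide_eq_true_eq, List.any_eq_true] at h
  rcases h with h | ⟨M, hM, hres⟩
  · exact absurd h (not_lt.mpr (mul_self_nonneg m))
  · have hM0 : 0 < M := by
      simp only [moduli, List.mem_cons, List.mem_nil_iff, or_false] at hM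
      rcases hM with h|h|h|h|h|h|h|h|h|h|h|h|h <;> omega
    exact nonResidue_sq_false hM0 m hres

/-- Soundness of `notSqClass`: `H ≠ m² · D` (`D ≠ 0`). [cite: EsmondeMurty1999, Ex. 6.5.12 and Ex. 6.5.21 p. 93] -/
theorem ne_sq_mul_of_notSqClass {D H : ℤ} (hD : D ≠ 0) (h : notSqClass D H = true) (m : ℤ) : H ≠ m ^ 2 * D := by
  intro hm
  rw [notSqClass, Bool.or_eq_true, Bool.not_eq_true', decide_eq_false_iff_not] at h
  rcases h with h | h
  · exact h (by rw [hm, Int.mul_emod_left])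
  · rw [hm, Int.mul_ediv_cancel _ hD] at h
    exact not_isSquare_of_nonSquare h ⟨m, by ring⟩

/-- Soundness of `hasIntRoot`: a root `r ∈ {±1, ±2}` with `χ_s(r) = 0`. [cite: EsmondeMurty1999, Ex. 6.5.12 and Ex. 6.5.21 p. 93] -/
theorem exists_root_of_hasIntRoot {s : ℤ × ℤ × ℤ × ℤ} (h : hasIntRoot s = true) :
    ∃ r : ℤ, (r = 1 ∨ r = -1 ∨ r = 2 ∨ r = -2) ∧ chiAt s r = 0 := by
  rw [hasIntRoot, List.any_eq_true] at h
  obtain ⟨r, hr, h0⟩ := h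
  refine ⟨r, ?_, by simpa using h0⟩
  simpa using hr

/-- Soundness of `powKill`: some `k` with `4c^k < 100^k |p_k|`. [cite: EsmondeMurty1999, Ex. 6.5.12 and Ex. 6.5.21 p. 93] -/
theorem exists_of_powKill {c : ℕ} {s : ℤ × ℤ × ℤ × ℤ} (h : powKill c s = true) :
    ∃ k : ℕ, 4 * (c : ℤ) ^ k < 100 ^ k * |psum s k| := by
  rw [powKill, List.any_eq_true] at h
  obtain ⟨k, -, hk⟩ := h
  exact ⟨k, of_decide_eq_true hk⟩

/-- Soundness of `checkSqrt`: in any commutative ring where `χ_s(x) = 0`, `g(x)² = d` with `d` a non-square integer.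
[cite: EsmondeMurty1999, Ex. 6.5.12 and Ex. 6.5.21 p. 93] -/
theorem sq_eq_of_checkSqrt {R : Type*} [CommRing R] {s : ℤ × ℤ × ℤ × ℤ} {w : List ℤ × ℤ × List ℤ}
    (h : checkSqrt s w = true) {x : R} (hx : evalL (chiL s) x = 0) :
    (evalL w.1 x) ^ 2 = (w.2.1 : R) ∧ ¬ IsSquare w.2.1 := by
  rw [checkSqrt, Bool.and_eq_true] at h
  refine ⟨?_, not_isSquare_of_nonSquare h.2⟩
  have h0 := evalL_eq_zero_of_isZeroL x _ h.1
  simp only [evalL_addL, evalL_mulL, evalL_smulL, evalL_cons, evalL_nil, hx] at h0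
  push_cast at h0
  linear_combination h0

/-- Soundness of `checkPos`, algebraic part: `s₁ = −2u`, the quartic is `(t² + ut + v)²` plus a positive definite
quadratic — so it is positive on `ℝ` — and the power-sum inequality holds. [cite: EsmondeMurty1999, Ex. 6.5.12 and Ex. 6.5.21 p. 93] -/
theorem pos_of_checkPos {s : ℤ × ℤ × ℤ × ℤ} {w : ℤ × ℤ × ℕ} (h : checkPos s w = true) :
    (∀ t : ℝ, 0 < t ^ 4 - (s.1 : ℝ) * t ^ 3 + (s.2.1 : ℝ) * t ^ 2 - (s.2.2.1 : ℝ) * t + (s.2.2.2 : ℝ)) ∧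
      2 * ((210 : ℤ) ^ w.2.2 + 120 ^ w.2.2) < 100 ^ w.2.2 * |psum s w.2.2| := by
  simp only [checkPos, Bool.and_eq_true, decide_eq_true_eq] at h
  obtain ⟨⟨⟨hu, hq2⟩, hdisc⟩, hk⟩ := h
  refine ⟨fun t => ?_, hk⟩
  set u := w.1; set v := w.2.1
  set q2 := s.2.1 - u ^ 2 - 2 * v
  set q1 := -s.2.2.1 - 2 * u * v
  set q0 := s.2.2.2 - v ^ 2
  have hs1 : (s.1 : ℝ) = -2 * (u : ℝ) := by exact_mod_cast (by linarith : s.1 = -2 * u)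
  have hid : t ^ 4 - (s.1 : ℝ) * t ^ 3 + (s.2.1 : ℝ) * t ^ 2 - (s.2.2.1 : ℝ) * t + (s.2.2.2 : ℝ)
      = (t ^ 2 + u * t + v) ^ 2 + ((q2 : ℝ) * t ^ 2 + (q1 : ℝ) * t + (q0 : ℝ)) := by
    simp only [q2, q1, q0]; push_cast; rw [hs1]; ring
  rw [hid]
  have hq2R : (0 : ℝ) < q2 := by exact_mod_cast hq2
  have hdR : (0 : ℝ) < 4 * (q2 : ℝ) * q0 - (q1 : ℝ) ^ 2 := by exact_mod_cast hdisc
  have hquad : 0 < (q2 : ℝ) * t ^ 2 + (q1 : ℝ) * t + (q0 : ℝ) := by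
    have : 4 * (q2 : ℝ) * ((q2 : ℝ) * t ^ 2 + (q1 : ℝ) * t + (q0 : ℝ))
        = (2 * (q2 : ℝ) * t + q1) ^ 2 + (4 * (q2 : ℝ) * q0 - (q1 : ℝ) ^ 2) := by ring
    nlinarith [sq_nonneg (2 * (q2 : ℝ) * t + q1)]
  nlinarith [sq_nonneg (t ^ 2 + u * t + v)]

/-- Unfolding of `certOK`. [cite: EsmondeMurty1999, Ex. 6.5.12 and Ex. 6.5.21 p. 93] -/
theorem certOK_cases {D : ℤ} {c : ℕ} {sq : List ((ℤ × ℤ × ℤ × ℤ) × (List ℤ × ℤ × List ℤ))}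
    {ps : List ((ℤ × ℤ × ℤ × ℤ) × (ℤ × ℤ × ℕ))} {s : ℤ × ℤ × ℤ × ℤ} (h : certOK D c sq ps s = true) :
    notSqClass D (hankelDet s) = true ∨ hasIntRoot s = true ∨ powKill c s = true ∨
      (∃ w, checkSqrt s w = true) ∨ (∃ w, checkPos s w = true) := by
  simp only [certOK, Bool.or_eq_true, List.any_eq_true, Bool.and_eq_true, decide_eq_true_eq] at h
  rcases h with (((h | h) | h) | ⟨e, -, rfl, he⟩) | ⟨e, -, rfl, he⟩
  · exact Or.inl h
  · exact Or.inr (Or.inl h)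
  · exact Or.inr (Or.inr (Or.inl h))
  · exact Or.inr (Or.inr (Or.inr (Or.inl ⟨_, he⟩)))
  · exact Or.inr (Or.inr (Or.inr (Or.inr ⟨_, he⟩)))

/-! ## Newton power sums: the recurrence is sound for four roots -/

/-- If `z₀,…,z₃` are roots of `χ_s` in a commutative ring with the integers `s₁ = e₁(z)`, `s₂ = e₂(z)`, `s₃ = e₃(z)`,
then `psum s n = ∑ zᵢ^n` for all `n`. [cite: EsmondeMurty1999, Ex. 6.5.12 and Ex. 6.5.21 p. 93] -/
theorem psum_eq_sum_pow {R : Type*} [CommRing R] [CharZero R] {s : ℤ × ℤ × ℤ × ℤ} {z₀ z₁ z₂ z₃ : R}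
    (h₁ : (s.1 : R) = z₀ + z₁ + z₂ + z₃)
    (h₂ : (s.2.1 : R) = z₀ * z₁ + z₀ * z₂ + z₀ * z₃ + z₁ * z₂ + z₁ * z₃ + z₂ * z₃)
    (h₃ : (s.2.2.1 : R) = z₀ * z₁ * z₂ + z₀ * z₁ * z₃ + z₀ * z₂ * z₃ + z₁ * z₂ * z₃)
    (r₀ : evalL (chiL s) z₀ = 0) (r₁ : evalL (chiL s) z₁ = 0) (r₂ : evalL (chiL s) z₂ = 0)
    (r₃ : evalL (chiL s) z₃ = 0) (n : ℕ) :
    ((psum s n : ℤ) : R) = z₀ ^ n + z₁ ^ n + z₂ ^ n + z₃ ^ n := by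
  rw [evalL_chiL] at r₀ r₁ r₂ r₃
  -- the 4-window invariant
  suffices H : ∀ n : ℕ, (((psum4 s n).1 : ℤ) : R) = z₀ ^ n + z₁ ^ n + z₂ ^ n + z₃ ^ n ∧
      (((psum4 s n).2.1 : ℤ) : R) = z₀ ^ (n+1) + z₁ ^ (n+1) + z₂ ^ (n+1) + z₃ ^ (n+1) ∧
      (((psum4 s n).2.2.1 : ℤ) : R) = z₀ ^ (n+2) + z₁ ^ (n+2) + z₂ ^ (n+2) + z₃ ^ (n+2) ∧
      (((psum4 s n).2.2.2 : ℤ) : R) = z₀ ^ (n+3) + z₁ ^ (n+3) + z₂ ^ (n+3) + z₃ ^ (n+3) by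
    exact (H n).1
  intro n
  induction n with
  | zero =>
    simp only [psum4, Int.cast_ofNat, pow_zero, zero_add, pow_one, Int.cast_sub, Int.cast_pow, Int.cast_mul,
      Int.cast_add]
    refine ⟨by norm_num, h₁, ?_, ?_⟩
    · rw [h₁, h₂]; ring
    · rw [h₁, h₂, h₃]; ring
  | succ n ih =>
    obtain ⟨i0, i1, i2, i3⟩ := ih
    refine ⟨?_, ?_, ?_, ?_⟩
    · simp only [psum4]; rw [i1]
    · simp only [psum4]; rw [i2]
    · simp only [psum4]; rw [i3]
    · simp only [psum4, Int.cast_sub, Int.cast_add, Int.cast_mul]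
      rw [i0, i1, i2, i3]
      have e0 := r₀; have e1 := r₁; have e2 := r₂; have e3 := r₃
      linear_combination (-(z₀ ^ n)) * e0 - z₁ ^ n * e1 - z₂ ^ n * e2 - z₃ ^ n * e3

end QuarticCert

end Literature.NumberTheory.NumberFields

/-! ## Note
The certificate TABLES and the two kernel checks (`decide`) over the Minkowski boxes live in
`QuarticSmallDiscriminant.lean`; this file is the table-independent checker. (Comment-only re-land 2026-08-27 to
refresh the farm's olean feed; declarations byte-identical.) -/
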